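import Summits.BirchSwinnertonDyer.BirchSwinnertonDyer.Theorems.PrintCf2RamifiedOffTYZGenusPeriodNormCriterion
import HarnessLib

/-!
# The same reading INSIDE `ℍ′_n` for the blocks `d ≡ 5, 6 (mod 8)` (whose CM points the tree already displays in `A(ℍ′_n)`): the `2`-descent class of
# the genus point `Z(d) = Σ_{t∈Φ₀} z_d^t` is the class of the Φ₀-product of `x(z_d^t) − 2i`, and the law GP0 on R1 follows from six non-square
# conditions in `ℍ′_n` — no extension field, no descent (crux stmt-BirchSwinnertonDyer-20509, line `offtyz-v7`, LEAD g26, cycle 27, part 8)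

HONEST FRAMING (cell `bsd-print-cf2`, route `PrintCf2`; `--supports stmt-BirchSwinnertonDyer-20509`; theorems only, `def`-free, no `sorry`).
BSD is not proved by any of this; no class is closed by this file; item 23431 (C⁺) and crux 20509 stay OPEN.

Parts 6–7 (p790023, p790211) read the genus period of a SEVEN-block in an extension `M ⊇ ℍ′_n` (its CM point `z_d ∈ A(H_d)` is not in `A(ℍ′_n)`).
For the blocks `d ≡ 5, 6 (mod 8)` the source puts `H′_d ⊂ ℍ′_n` (p0011 L58–L62), and the tree's CM-point layer (`CMPointGaloisDisplays.CMBlockSpec`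
(G1): "`Z(d) = Σ_{t∈Φ₀} z_d^t`, `#Φ₀ = g(d)`", inside `CMPointCompositumPrinted`) displays `z_d ∈ A(ℍ′_n)` and the half-system `Φ₀ ⊂ Aut_ℚ(ℍ′_n)`.  So the
identity of part 6 holds INSIDE `ℍ′_n`, with no descent ambiguity at all:

* §1 ★★★ `twoDescentComponent_genusPoint_eq_prod` — for any block datum `Z(d) = Σ_{t∈Φ} z^t` in `A(ℍ′_n)` with `z = (x₀, y₀)` and no `z^t` a cusp:
  **`κ_{ℍ′}(Z(d)) = [∏_{t∈Φ} (t x₀ − 2i)]` in `ℍ′_n^×/ℍ′_n^{×2}`** (the `T⁺`-component; Silverman X.1.4).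
* §2 ★★★ `sqClass_prod_mem_torsionClasses_of_twoDivisible` / `genusPoint_not_twoDivisible_of_prod` — odd `n`, Lemma 3.18: `Z(d) ∈ 2A(ℍ′_n) + tors` ⟹
  the class is one of `[1], [−2i], [−8], [−4i], [2 − 2i], [−2 − 2i]`; contrapositively **six non-square conditions IN `ℍ′_n` ⟹ `Z(d) ∉ 2A(ℍ′_n) + tors`.**
* §3 ★★ `genusPoint_not_twoDivisible_R1_of_prod` — BY NAME on R1 (`n = lm`, `l ≡ 1`, `m ≡ 5 (mod 8)`; `n` is its own five-block): from the display
  package (`Printed` + CM-point layer (G1)) and the non-cusp hypothesis on the displayed CM points, the six non-square conditions on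
  `∏_{t∈Φ₀}(x(z_n^t) − 2i)` in `ℍ′_n` give the law GP0-R1 «`Z(lm) ∉ 2A(ℍ′_n) + tors`» — which on the visible rows is C⁺'s reading `[Z(lm)] = [Q₁] ≠ 0`
  up to the identification of the class (`TwoPrimesByName.levelTwo_two_primes_iff_visible`).

CAVEAT (g24): for `d ≡ 5, 6` the product runs over the HALF-system `Φ₀` (representatives of `2Cl′_d/⟨σ⟩`), so it is NOT a Galois norm — its square class
is still ONE explicit algebraic number of `ℍ′_n` per row, the R1 twin of the U-road target.  The non-cusp hypothesis (`z_d^t ∉ A[(1+i)³]`) is not among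
the displayed sentences (G1)–(G7) and is carried explicitly.

References: [cite: TianYuanZhang2017, §3.1 (p0011 L53–L66), §3.2 (p0012 L8–L18), Lemma 3.16 (p0017 L98–L113), Lemma 3.18 (p0017 L152–L153), Thm. 3.6];
[cite: SilvermanAEC2009, Prop. X.1.4]; tree: parts 6–7 (`…GenusPeriodNormClass`, `…GenusPeriodNormCriterion`), `TianYuanZhang2017/CMPointGaloisDisplays` ((G1)).
-/

noncomputable section

open scoped Classical

open WeierstrassCurve WeierstrassCurve.Affine WeierstrassCurve.Affine.Point
  Literature.NumberTheory.EllipticCurves Literature.NumberTheory.EllipticCurves.Rank1Residual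
  Literature.NumberTheory.EllipticCurves.TianYuanZhang2017
  Literature.NumberTheory.EllipticCurves.TianYuanZhang2017.GenusPointData
  Summit.BirchSwinnertonDyer.PrintCf2.GenusPeriodNorm
  Summit.BirchSwinnertonDyer.PrintCf2.GenusPeriodNormCriterion

set_option autoImplicit false

namespace Summit.BirchSwinnertonDyer.PrintCf2.GenusPointHalfTraceClass

variable {n : ℕ}

/-! ## §1 The class of a displayed orbit-type sum inside `A(ℍ′_n)` -/

/-- `galPt` IS `galPtOver ℍ′_n` (both are `Affine.Point.map` of the automorphism). [cite: TianYuanZhang2017, §3.1 (p0011 L53–L58)] -/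
theorem galPt_eq_galPtOver (D : GenusPointData n) (t : D.H ≃ₐ[ℚ] D.H) : D.galPt t = galPtOver D.H t := rfl

/-- ★★★ **`κ_{ℍ′}(Z(d)) = [∏_{t∈Φ} (t x₀ − 2i)]` INSIDE `ℍ′_n`**: for a genus point displayed as `Z(d) = Σ_{t∈Φ} z^t` with `z = (x₀, y₀) ∈ A(ℍ′_n)`
(blocks `d ≡ 5, 6`: (G1) of the CM-point layer) and no `z^t` a cusp, the `2`-descent component at `T⁺ = (2i, 0)` of `Z(d)` is the class of the
Φ-product of the CM values of `x − 2i`. [cite: TianYuanZhang2017, §3.1 (p0011 L53–L56)] [cite: SilvermanAEC2009, Prop. X.1.4] -/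
theorem twoDescentComponent_genusPoint_eq_prod (D : GenusPointData n) {d : ℕ} {x₀ y₀ : D.H}
    (h₀ : (curveA.baseChange D.H).toAffine.Nonsingular x₀ y₀) (Φ : Finset (D.H ≃ₐ[ℚ] D.H))
    (hG1 : D.Z d = ∑ t ∈ Φ, D.galPt t (.some x₀ y₀ h₀))
    (hnc : ∀ t ∈ Φ, ¬ ((2 : ℕ) • D.galPt t (.some x₀ y₀ h₀) = 0 ∨ (2 : ℕ) • D.galPt t (.some x₀ y₀ h₀) = tauOne)) :
    Point.twoDescentComponent (curveA.baseChange D.H).toAffine (2 * D.im) 0 (-(2 * D.im)) (D.Z d) =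
      ∏ t ∈ Φ, sqClass (t x₀ - 2 * D.im) := by
  have hsplit := splitTwoTorsion_over D.im_sq
  rw [hG1]
  have hterm : ∀ t ∈ Φ, D.galPt t (.some x₀ y₀ h₀) =
      .some (t x₀) (t y₀) (nonsingular_apply_of_fixed (W := (curveA.baseChange D.H).toAffine) (t : D.H →+* D.H)
        (coeff_fixed_over t).1 (coeff_fixed_over t).2.1 (coeff_fixed_over t).2.2.1 (coeff_fixed_over t).2.2.2.1 (coeff_fixed_over t).2.2.2.2 h₀) :=
    fun t _ => by rw [galPt_eq_galPtOver]; exact galPtOver_some t h₀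
  rw [Finset.sum_congr rfl hterm]
  refine twoDescentComponent_sum_apply hsplit Φ (fun t => (t : D.H →+* D.H)) (fun t => (coeff_fixed_over t).1) (fun t => (coeff_fixed_over t).2.1)
    (fun t => (coeff_fixed_over t).2.2.1) (fun t => (coeff_fixed_over t).2.2.2.1) (fun t => (coeff_fixed_over t).2.2.2.2) h₀ ?_
  intro t ht
  have h2 : (2 : ℕ) • D.galPt t (.some x₀ y₀ h₀) ≠ 0 := fun h0 => hnc t ht (Or.inl h0)
  rw [hterm t ht] at h2
  exact (X_ne_of_two_smul_ne_zero D.im_sq _ h2).1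

/-! ## §2 The law GP0 inside `ℍ′_n`: torsion classes and the non-square criterion -/

/-- ★★★ **`Z(d) ∈ 2A(ℍ′_n) + tors ⟹` the Φ-product class is a torsion class** (odd `n`, Lemma 3.18): one of `[1], [−2i], [−8], [−4i], [2 − 2i], [−2 − 2i]`
in `ℍ′_n^×/ℍ′_n^{×2}`. [cite: TianYuanZhang2017, Lemma 3.18 (p0017 L152–L153), Lemma 3.16, §3.1] [cite: SilvermanAEC2009, Prop. X.1.4] -/
theorem sqClass_prod_mem_torsionClasses_of_twoDivisible (D : GenusPointData n) (hodd : Odd n) (h318 : D.lemma318) {d : ℕ} {x₀ y₀ : D.H}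
    (h₀ : (curveA.baseChange D.H).toAffine.Nonsingular x₀ y₀) (Φ : Finset (D.H ≃ₐ[ℚ] D.H))
    (hG1 : D.Z d = ∑ t ∈ Φ, D.galPt t (.some x₀ y₀ h₀))
    (hnc : ∀ t ∈ Φ, ¬ ((2 : ℕ) • D.galPt t (.some x₀ y₀ h₀) = 0 ∨ (2 : ℕ) • D.galPt t (.some x₀ y₀ h₀) = tauOne))
    (h2 : ∃ y : APoint D.H, IsOfFinAddOrder (D.Z d - (2 : ℤ) • y)) :
    let N := ∏ t ∈ Φ, ((t : D.H ≃ₐ[ℚ] D.H) x₀ - 2 * D.im)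
    sqClass N = sqClass (1 : D.H) ∨ sqClass N = sqClass (-(2 * D.im)) ∨ sqClass N = sqClass (-8 : D.H) ∨
      sqClass N = sqClass (-(4 * D.im)) ∨ sqClass N = sqClass (2 - 2 * D.im) ∨ sqClass N = sqClass (-2 - 2 * D.im) := by
  intro N
  have him := D.im_sq
  obtain ⟨y, hy⟩ := h2
  set t₀ : APoint D.H := D.Z d - (2 : ℤ) • y with ht₀
  obtain ⟨-, h2t⟩ := h318.1 hodd t₀ hy
  have hZ : D.Z d = t₀ + (2 : ℤ) • y := by rw [ht₀, sub_add_cancel]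
  have hne : ∀ t ∈ Φ, (t : D.H ≃ₐ[ℚ] D.H) x₀ - 2 * D.im ≠ 0 := by
    intro t ht
    have h2' : (2 : ℕ) • D.galPt t (.some x₀ y₀ h₀) ≠ 0 := fun h0 => hnc t ht (Or.inl h0)
    rw [galPt_eq_galPtOver, galPtOver_some t h₀] at h2'
    exact sub_ne_zero.mpr (X_ne_of_two_smul_ne_zero him _ h2').1
  have hN : sqClass N = twoDescentComponent (curveA.baseChange D.H).toAffine (2 * D.im) 0 (-(2 * D.im)) t₀ := by
    rw [sqClass_prod_of_ne_zero Φ _ hne, ← twoDescentComponent_genusPoint_eq_prod D h₀ Φ hG1 hnc, hZ,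
      twoDescentComponent_add_two_zsmul him]
  rw [hN]
  rcases h2t with h0 | h1
  · rcases twoDescentComponent_of_two_nsmul_eq_zero him h0 with e | e | e | e
    · exact Or.inl e
    · exact Or.inr (Or.inl e)
    · exact Or.inr (Or.inr (Or.inl e))
    · exact Or.inr (Or.inr (Or.inr (Or.inl e)))
  · rcases twoDescentComponent_of_two_nsmul_eq_tauOne him h1 with e | e
    · exact Or.inr (Or.inr (Or.inr (Or.inr (Or.inl e))))
    · exact Or.inr (Or.inr (Or.inr (Or.inr (Or.inr e))))

/-- ★★★ **THE LAW GP0 INSIDE `ℍ′_n` FROM SIX NON-SQUARE CONDITIONS**: odd `n`, Lemma 3.18, a displayed orbit-type sum `Z(d) = Σ_{t∈Φ} z^t` in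
`A(ℍ′_n)` with no `z^t` a cusp; if `(∏_{t∈Φ}(t x₀ − 2i))·w` is a non-square in `ℍ′_n` for each `w ∈ {1, −2i, −8, −4i, 2 − 2i, −2 − 2i}`, then
**`Z(d) ∉ 2A(ℍ′_n) + A(ℍ′_n)_tor`.** [cite: TianYuanZhang2017, Lemma 3.18, Lemma 3.16, §3.1] [cite: SilvermanAEC2009, Prop. X.1.4] -/
theorem genusPoint_not_twoDivisible_of_prod (D : GenusPointData n) (hodd : Odd n) (h318 : D.lemma318) {d : ℕ} {x₀ y₀ : D.H}
    (h₀ : (curveA.baseChange D.H).toAffine.Nonsingular x₀ y₀) (Φ : Finset (D.H ≃ₐ[ℚ] D.H))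
    (hG1 : D.Z d = ∑ t ∈ Φ, D.galPt t (.some x₀ y₀ h₀))
    (hnc : ∀ t ∈ Φ, ¬ ((2 : ℕ) • D.galPt t (.some x₀ y₀ h₀) = 0 ∨ (2 : ℕ) • D.galPt t (.some x₀ y₀ h₀) = tauOne))
    (hns : ∀ w ∈ ({1, -(2 * D.im), -8, -(4 * D.im), 2 - 2 * D.im, -2 - 2 * D.im} : Finset D.H),
      ¬ IsSquare ((∏ t ∈ Φ, ((t : D.H ≃ₐ[ℚ] D.H) x₀ - 2 * D.im)) * w)) :
    ¬ ∃ y : APoint D.H, IsOfFinAddOrder (D.Z d - (2 : ℤ) • y) := by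
  intro h2
  have him := D.im_sq
  have hi0 : D.im ≠ 0 := fun h => by rw [h] at him; norm_num at him
  have hne : ∀ t ∈ Φ, (t : D.H ≃ₐ[ℚ] D.H) x₀ - 2 * D.im ≠ 0 := by
    intro t ht
    have h2' : (2 : ℕ) • D.galPt t (.some x₀ y₀ h₀) ≠ 0 := fun h0 => hnc t ht (Or.inl h0)
    rw [galPt_eq_galPtOver, galPtOver_some t h₀] at h2'
    exact sub_ne_zero.mpr (X_ne_of_two_smul_ne_zero him _ h2').1
  have hN0 : (∏ t ∈ Φ, ((t : D.H ≃ₐ[ℚ] D.H) x₀ - 2 * D.im)) ≠ 0 := Finset.prod_ne_zero_iff.mpr hne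
  have w2 : (2 - 2 * D.im : D.H) ≠ 0 := by
    intro h
    have : D.im = 1 := by linear_combination (-1/2 : D.H) * h
    rw [this] at him; norm_num at him
  have wm2 : (-2 - 2 * D.im : D.H) ≠ 0 := by
    intro h
    have : D.im = -1 := by linear_combination (-1/2 : D.H) * h
    rw [this] at him; norm_num at him
  have key := sqClass_prod_mem_torsionClasses_of_twoDivisible D hodd h318 h₀ Φ hG1 hnc h2
  simp only at key
  rcases key with e | e | e | e | e | e
  · exact hns 1 (by simp) (isSquare_mul_of_sqClass_eq hN0 one_ne_zero e)
  · exact hns _ (by simp) (isSquare_mul_of_sqClass_eq hN0 (neg_ne_zero.mpr (mul_ne_zero two_ne_zero hi0)) e)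
  · exact hns (-8) (by simp) (isSquare_mul_of_sqClass_eq hN0 (by norm_num) e)
  · exact hns _ (by simp) (isSquare_mul_of_sqClass_eq hN0 (neg_ne_zero.mpr (mul_ne_zero (by norm_num) hi0)) e)
  · exact hns _ (by simp) (isSquare_mul_of_sqClass_eq hN0 w2 e)
  · exact hns _ (by simp) (isSquare_mul_of_sqClass_eq hN0 wm2 e)

/-! ## §3 By name on R1: the five-block `n = lm` and its displayed CM points -/

/-- ★★ **GP0-R1 FROM THE HALF-PRODUCT, BY NAME.**  Primes `l ≡ 1`, `m ≡ 5 (mod 8)`, `n = lm` (so `n ≡ 5 (mod 8)` is its own block); a display package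
`D` of `n` with `Printed` and the CM-point layer `CMPointCompositumPrinted`.  Then there are the displayed CM point `z = z_n ∈ A(ℍ′_n)` and half-system
`Φ = Φ₀` (`#Φ = g(n)`) with `Z(n) = Σ_{t∈Φ} z^t` ((G1)), and: **if no `z^t` is a cusp and `(∏_{t∈Φ}(x(z^t) − 2i))·w` is a non-square in `ℍ′_n` for the
six torsion classes `w`, then `Z(lm) ∉ 2A(ℍ′_n) + tors`** (the law GP0-R1; on visible rows it is the class side of C⁺'s reading `[Z(lm)] = [Q₁]`).
[cite: TianYuanZhang2017, §3.1 (p0011 L1–L13, L53–L58), Lemma 3.18, Lemma 3.16] [cite: SilvermanAEC2009, Prop. X.1.4] -/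
theorem genusPoint_not_twoDivisible_R1_of_prod {l m : ℕ} (hl : l.Prime) (hm : m.Prime) (hl8 : l % 8 = 1) (hm8 : m % 8 = 5) (hn : n = l * m)
    (D : GenusPointData n) (hPr : D.Printed) (hC : D.CMPointCompositumPrinted) :
    ∃ (z : APoint D.H) (Φ : Finset (D.H ≃ₐ[ℚ] D.H)), D.Z n = ∑ t ∈ Φ, D.galPt t z ∧ Φ.card = gK n ∧
      ∀ {x₀ y₀ : D.H} (h₀ : (curveA.baseChange D.H).toAffine.Nonsingular x₀ y₀), z = .some x₀ y₀ h₀ →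
        (∀ t ∈ Φ, ¬ ((2 : ℕ) • D.galPt t (.some x₀ y₀ h₀) = 0 ∨ (2 : ℕ) • D.galPt t (.some x₀ y₀ h₀) = tauOne)) →
        (∀ w ∈ ({1, -(2 * D.im), -8, -(4 * D.im), 2 - 2 * D.im, -2 - 2 * D.im} : Finset D.H),
          ¬ IsSquare ((∏ t ∈ Φ, ((t : D.H ≃ₐ[ℚ] D.H) x₀ - 2 * D.im)) * w)) →
        ¬ ∃ y : APoint D.H, IsOfFinAddOrder (D.Z n - (2 : ℤ) • y) := by
  have hmod8 : n % 8 = 5 := by rw [hn, Nat.mul_mod, hl8, hm8]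
  have hne : l ≠ m := fun h => by subst h; omega
  have hsq : Squarefree n := by
    subst hn
    exact Nat.squarefree_mul_iff.mpr ⟨(Nat.coprime_primes hl hm).mpr hne, hl.squarefree, hm.squarefree⟩
  have hodd : Odd n := Nat.odd_iff.mpr (by omega)
  have hnd : n ∈ n.divisors := Nat.mem_divisors_self n hsq.ne_zero
  obtain ⟨z, Φ, ΓH, ΓH', σ, θ, c, ρ₂, ρ₄, -, hblocks, -⟩ := hC
  obtain ⟨⟨hG1, hcard⟩, -⟩ := (hblocks n hnd).1 (Or.inl hmod8)
  refine ⟨z n, Φ n, hG1, hcard, fun h₀ hz hnc hns => ?_⟩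
  rw [hz] at hG1
  exact genusPoint_not_twoDivisible_of_prod D hodd hPr.2.2.2.2.2.2.2.2.1 h₀ (Φ n) hG1 hnc hns

end Summit.BirchSwinnertonDyer.PrintCf2.GenusPointHalfTraceClass

end
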